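import Literature.AlgebraicGeometry.Motives.MixedHodgeStructureHodgeTateDevissage
import Literature.AlgebraicGeometry.Motives.MixedHodgeStructureAbelianUniversal
import Literature.AlgebraicGeometry.Motives.MixedHodgeExtensionTate
import HarnessLib

/-!
# Hodge–Tate structures: morphisms to Tate structures and the top Tate quotient

Goncharov, *Multiple polylogarithms and mixed Tate motives* (arXiv:math/0103059), §3.1: in a mixed
Tate category every object `M` carries a canonical weight filtration indexed by `2ℤ` with `gr^W_{2n} M`
a direct sum of copies of `K(−n)`, and the fibre functor is built from `Hom(K(−n), gr^W_{2n} M)`; an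
`n`-framing of `M` is a pair of non-zero morphisms `K(−n) → gr^W_{2n} M`, `gr^W_{2m} M → K(−m)`, i.e.
maps FROM a Tate object into the bottom and TO a Tate object out of the top graded piece. §4.1: the
Hodge realisation is the category `𝓗_T` of Hodge–Tate structures (the tree's
`MixedHodgeStructure.IsHodgeTate`, `Motives/MixedHodgeStructureHodgeTate`). Marcolli, *Feynman motives*
(2010), after (2.49): "`M` is mixed Tate if `gr^W_{2p} M = ⊕ ℚ(−p)` and `gr^W_{2p−1} M = 0`".

`Motives/MixedHodgeStructureHodgeTateDevissage` proved the SUB side: a non-zero Hodge–Tate structure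
contains a Tate structure `ℚ(−k) ↪ H` at its lowest weight (`IsHodgeTate.exists_hom_tate_injective`),
through `Hom(ℚ(−k), H) ≃ Hdgᵏ(H)` (`tateHomEquivHodgeClasses`). This file proves the QUOTIENT side —
the morphisms `H → ℚ(−m)` — for a Hodge–Tate structure `H` on a finite-dimensional `ℚ`-space `V`:

* §1 (any MHS) **a linear map is a morphism of mixed Hodge structures as soon as weights and Hodge
  types separate it**: if `W_{n−1} H₁ = 0`, `W_n H₂ = H₂`, `F^{p+1} H₁ = 0`, `F^p H₂ = H₂`, every
  `ℚ`-linear `V₁ → V₂` is a morphism `H₁ → H₂` (`Hom.ofBounds`); in particular every linear functional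
  on an MHS with `W_{2m−1} = 0`, `F^{m+1} = 0` is a morphism to `ℚ(−m)` (`Hom.toTateOfBounds`) and every
  vector of an MHS with `W_{2m} = ⊤`, `F^m = ⊤` spans a morphism from `ℚ(−m)` (`Hom.ofTateOfBounds`).
* §2 the highest weight: `∃ n, W_n = V ∧ W_{n−1} ≠ V` (`exists_highestWeight`, any MHS on `V ≠ 0`),
  even for a Hodge–Tate structure (`IsHodgeTate.exists_highestWeight_even`).
* §3 for a Hodge–Tate structure: `W_{2m} = V ⇒ F^{m+1} = 0` (`IsHodgeTate.F_succ_eq_bot_of_W_eq_top`)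
  and `W_{2m−1} = 0 ⇒ F^m = V_ℂ` (`IsHodgeTate.F_eq_top_of_W_pred_eq_bot`) — `V_ℂ = ⊕_r I^{r,r}` and
  `I^{r,r} ⊆ W_{2r}`, `I^{r,r} ∩ W_{2r−1} = 0`.
* §4 **`Hom(H, ℚ(−m)) ≃ (W_{2m−1} H)^⊥ ⊆ V^*` for a Hodge–Tate structure of weights `≤ 2m`**
  (`IsHodgeTate.homTateEquivDualAnnihilator`; the map `φ ↦` the morphism `IsHodgeTate.homTateOfLE`
  through the pure Tate quotient `H / W_{2m−1} H`) — the dual of `Hom(ℚ(−k), H) ≃ Hdgᵏ(H)`; every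
  morphism to `ℚ(−m)` kills `W_{2m−1}` (`Hom.W_pred_le_ker`, any MHS; companion of the tree's
  `Hom.range_le_W`, `MixedHodgeExtensionTateNonSeparatedFunctorial`).
* §5 **the top Tate quotient**: a non-zero Hodge–Tate structure has a SURJECTIVE morphism
  `H ↠ ℚ(−m)` at its highest weight `2m` (`IsHodgeTate.exists_hom_tate_surjective`), hence is an
  extension `0 → K → H → ℚ(−m) → 0` of a Tate structure by the Hodge–Tate structure `K = Ker`, of
  dimension one less (`tateQuotientExtension`, `IsHodgeTate.exists_extension_tate_quotient`) — the
  shape `Ext(ℚ(−m), K) ≃ J⁰_W(K(m))` of the tree's `Ext.tateEquivJacobianW` applies to; iterating, `𝓗_T`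
  is generated by the `ℚ(n)` under extensions (Goncharov §3.1: "any simple object is isomorphic to one
  of" the `K(n)`).

All statements proved; two definitions with bodies besides the `Hom` constructors (`homTateEquiv…`,
`tateQuotientExtension`); no named facts.

## References

* [Goncharov2001MultiplePolylogarithms] A. B. Goncharov, Multiple polylogarithms and mixed Tate motives,
  arXiv:math/0103059 (2001), §3.1 (mixed Tate categories, canonical weight filtration, framings), §4.1
  (held text `paper:arxiv-math_0103059`, p0019, p0022).
* [Marcolli2009] M. Marcolli, Feynman motives, World Scientific (2010), §2.8, (2.49)–(2.51) and the
  paragraph after (held text `book:marcolli2009-feynman-motives`, p0088).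
* [DeligneHodgeII1971] P. Deligne, Théorie de Hodge II, Publ. Math. IHÉS 40 (1971), 2.1.13, 2.3.1.
* [CattaniElZeinGriffithsLe2014] E. Cattani et al. (eds.), Hodge Theory (2014), Prop. 3.2.19, Lemma 3.2.20.
-/

noncomputable section

open scoped TensorProduct

namespace Literature.AlgebraicGeometry.Motives

namespace MixedHodgeStructure

universe u v

variable {V : Type u} [AddCommGroup V] [Module ℚ V]
variable {V' : Type v} [AddCommGroup V'] [Module ℚ V']

open Module
open HodgeStructure (tate ofRat)

/-! ### §1 Linear maps that are automatically morphisms -/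

namespace Hom

variable {H₁ : MixedHodgeStructure V} {H₂ : MixedHodgeStructure V'}

/-- **A linear map separated by weights and Hodge types is a morphism of mixed Hodge structures**: if
the weights of `H₁` are `≥ n` (`W_{n-1} H₁ = 0`), the weights of `H₂` are `≤ n` (`W_n H₂ = H₂`), the
Hodge filtration of `H₁` stops at `p` (`F^{p+1} H₁ = 0`) and that of `H₂` is everything up to `p`
(`F^p H₂ = H₂`), then EVERY `ℚ`-linear map `V₁ → V₂` respects `W` and `F`.
[cite: DeligneHodgeII1971, 2.3.1] -/
def ofBounds (φ : V →ₗ[ℚ] V') (n p : ℤ) (h₁W : H₁.W (n - 1) = ⊥) (h₂W : H₂.W n = ⊤)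
    (h₁F : H₁.F (p + 1) = ⊥) (h₂F : H₂.F p = ⊤) : Hom H₁ H₂ where
  toLinearMap := φ
  map_W_le k := by
    by_cases hk : k ≤ n - 1
    · rw [eq_bot_iff.2 ((H₁.monotone_W hk).trans h₁W.le), Submodule.map_bot]
      exact bot_le
    · exact le_top.trans (h₂W.ge.trans (H₂.monotone_W (by omega)))
  map_F_le q := by
    by_cases hq : p + 1 ≤ q
    · rw [eq_bot_iff.2 ((H₁.antitone_F hq).trans h₁F.le), Submodule.map_bot]
      exact bot_le
    · exact le_top.trans (h₂F.ge.trans (H₂.antitone_F (by omega)))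

/-- Underlying map of `Hom.ofBounds` (by `rfl`). [cite: DeligneHodgeII1971, 2.3.1] -/
@[simp]
theorem ofBounds_toLinearMap (φ : V →ₗ[ℚ] V') (n p : ℤ) (h₁W : H₁.W (n - 1) = ⊥) (h₂W : H₂.W n = ⊤)
    (h₁F : H₁.F (p + 1) = ⊥) (h₂F : H₂.F p = ⊤) :
    (ofBounds φ n p h₁W h₂W h₁F h₂F : Hom H₁ H₂).toLinearMap = φ := rfl

/-- **Every linear functional on a mixed Hodge structure with `W_{2m-1} = 0` and `F^{m+1} = 0` is a
morphism to `ℚ(-m)`** (`ℚ(-m)`: weight `2m`, `F^m = ℂ`, `F^{m+1} = 0`). [cite: DeligneHodgeII1971, 2.1.13] -/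
def toTateOfBounds {H : MixedHodgeStructure V} (φ : V →ₗ[ℚ] ℚ) (m : ℤ) (hW : H.W (2 * m - 1) = ⊥)
    (hF : H.F (m + 1) = ⊥) : Hom H (tate (-m)).toMixedHodgeStructure :=
  ofBounds φ (2 * m) m hW (tate_toMixedHodgeStructure_W_of_le le_rfl) hF
    (tate_toMixedHodgeStructure_F_of_le le_rfl)

/-- Underlying map of `Hom.toTateOfBounds` (by `rfl`). [cite: DeligneHodgeII1971, 2.1.13] -/
@[simp]
theorem toTateOfBounds_toLinearMap {H : MixedHodgeStructure V} (φ : V →ₗ[ℚ] ℚ) (m : ℤ)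
    (hW : H.W (2 * m - 1) = ⊥) (hF : H.F (m + 1) = ⊥) :
    (toTateOfBounds φ m hW hF).toLinearMap = φ := rfl

/-- **Every vector of a mixed Hodge structure with `W_{2m} = V` and `F^m = V_ℂ` spans a morphism
`ℚ(-m) → H`, `q ↦ q • v`.** [cite: DeligneHodgeII1971, 2.1.13] -/
def ofTateOfBounds {H : MixedHodgeStructure V} (v : V) (m : ℤ) (hW : H.W (2 * m) = ⊤) (hF : H.F m = ⊤) :
    Hom (tate (-m)).toMixedHodgeStructure H :=
  ofBounds (LinearMap.toSpanSingleton ℚ V v) (2 * m) m (tate_toMixedHodgeStructure_W_of_lt (by omega)) hW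
    (tate_toMixedHodgeStructure_F_of_lt (by omega)) hF

/-- `Hom.ofTateOfBounds v` sends `q` to `q • v`. [cite: DeligneHodgeII1971, 2.1.13] -/
@[simp]
theorem ofTateOfBounds_toLinearMap_apply {H : MixedHodgeStructure V} (v : V) (m : ℤ) (hW : H.W (2 * m) = ⊤)
    (hF : H.F m = ⊤) (q : ℚ) : (ofTateOfBounds v m hW hF).toLinearMap q = q • v := rfl

/-- **Every morphism `H → ℚ(-m)` kills `W_{2m-1} H`** (`W_{2m-1} ℚ(-m) = 0`; any MHS).
[cite: DeligneHodgeII1971, 2.1.13] -/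
theorem W_pred_le_ker {H : MixedHodgeStructure V} {m : ℤ} (g : Hom H (tate (-m)).toMixedHodgeStructure) :
    H.W (2 * m - 1) ≤ LinearMap.ker g.toLinearMap := by
  intro x hx
  have h := g.map_W_le (2 * m - 1) ⟨x, hx, rfl⟩
  rwa [tate_toMixedHodgeStructure_W_of_lt (by omega), Submodule.mem_bot] at h

end Hom

/-! ### §2 The highest weight -/

/-- **A mixed Hodge structure on a non-zero space has a highest weight**: there is `n` with `W_n = V`
and `W_{n-1} ≠ V`. [cite: DeligneHodgeII1971, 2.3.1] -/
theorem exists_highestWeight [Nontrivial V] (H : MixedHodgeStructure V) :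
    ∃ n : ℤ, H.W n = ⊤ ∧ H.W (n - 1) ≠ ⊤ := by
  classical
  obtain ⟨t, ht⟩ := H.exists_W_eq_top
  obtain ⟨b, hb⟩ := H.exists_W_eq_bot
  have hbdd : ∃ b : ℤ, ∀ z : ℤ, H.W z = ⊤ → b ≤ z := by
    refine ⟨b, fun z hz => ?_⟩
    by_contra hzb
    have hle : H.W z ≤ H.W b := H.monotone_W (by omega)
    rw [hz, hb, top_le_iff] at hle
    exact bot_ne_top hle
  obtain ⟨n, hn, hmin⟩ := Int.exists_least_of_bdd hbdd ⟨t, ht⟩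
  refine ⟨n, hn, fun h => ?_⟩
  have := hmin (n - 1) h
  omega

/-- **The highest weight of a non-zero Hodge–Tate structure is even**: there is `m` with `W_{2m} = V`
and `W_{2m-1} ≠ V`. [cite: Goncharov2001MultiplePolylogarithms, §4.1] [cite: Marcolli2009, (2.49)] -/
theorem IsHodgeTate.exists_highestWeight_even [FiniteDimensional ℚ V] [Nontrivial V]
    {H : MixedHodgeStructure V} (h : H.IsHodgeTate) : ∃ m : ℤ, H.W (2 * m) = ⊤ ∧ H.W (2 * m - 1) ≠ ⊤ := by
  obtain ⟨n, hn, hn1⟩ := H.exists_highestWeight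
  obtain ⟨m, hm | hm⟩ := Int.even_or_odd' n
  · exact ⟨m, by rw [← hm]; exact hn, by rw [← hm]; exact hn1⟩
  · exfalso
    apply hn1
    rw [hm, add_sub_cancel_right, ← h.W_odd_eq m, ← hm, hn]

/-! ### §3 The Hodge filtration at the extreme weights of a Hodge–Tate structure -/

section Extreme

variable [FiniteDimensional ℚ V] {H : MixedHodgeStructure V}

omit [FiniteDimensional ℚ V] in
/-- If `W_{2m} = V` then `I^{r,r} = 0` for `r > m` (`I^{r,r} ∩ W_{2r-1} = 0` and `W_{2m} ⊆ W_{2r-1}`;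
any MHS). [cite: CattaniElZeinGriffithsLe2014, Prop. 3.2.19] -/
theorem deligneI_diag_eq_bot_of_W_eq_top {m r : ℤ} (hW : H.W (2 * m) = ⊤) (hr : m < r) :
    H.deligneI r r = ⊥ := by
  have h1 : (H.W (r + r - 1)).baseChange ℂ = ⊤ :=
    eq_top_iff.2 ((le_of_eq (by rw [hW, Submodule.baseChange_top])).trans
      (H.baseChange_W_mono (show 2 * m ≤ r + r - 1 by omega)))
  have h2 := H.deligneI_inf_W_pred_eq_bot r r
  rwa [h1, inf_top_eq] at h2

omit [FiniteDimensional ℚ V] in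
/-- If `W_{2m-1} = 0` then `I^{r,r} = 0` for `r < m` (`I^{r,r} ⊆ W_{2r} ⊆ W_{2m-1}`; any MHS).
[cite: CattaniElZeinGriffithsLe2014, Prop. 3.2.19] -/
theorem deligneI_diag_eq_bot_of_W_eq_bot {m r : ℤ} (hW : H.W (2 * m - 1) = ⊥) (hr : r < m) :
    H.deligneI r r = ⊥ :=
  eq_bot_iff.2 ((H.deligneI_le_W r r).trans ((H.baseChange_W_mono (show r + r ≤ 2 * m - 1 by omega)).trans
    (by rw [hW, Submodule.baseChange_bot])))

/-- **`W_{2m} = V ⇒ F^{m+1} = 0` for a Hodge–Tate structure** (`F^{m+1} = ⊕_{r > m} I^{r,r} = 0`).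
[cite: Goncharov2001MultiplePolylogarithms, §4.1] [cite: CattaniElZeinGriffithsLe2014, Prop. 3.2.19] -/
theorem IsHodgeTate.F_succ_eq_bot_of_W_eq_top (h : H.IsHodgeTate) {m : ℤ} (hW : H.W (2 * m) = ⊤) :
    H.F (m + 1) = ⊥ := by
  rw [h.F_eq_biSup_deligneI (m + 1)]
  exact iSup_eq_bot.2 fun r => iSup_eq_bot.2 fun hr => deligneI_diag_eq_bot_of_W_eq_top hW (by omega)

/-- **`W_{2m-1} = 0 ⇒ F^m = V_ℂ` for a Hodge–Tate structure** (`F^m = ⊕_{r ≥ m} I^{r,r} = ⊕_r I^{r,r}`).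
[cite: Goncharov2001MultiplePolylogarithms, §4.1] [cite: CattaniElZeinGriffithsLe2014, Prop. 3.2.19] -/
theorem IsHodgeTate.F_eq_top_of_W_pred_eq_bot (h : H.IsHodgeTate) {m : ℤ} (hW : H.W (2 * m - 1) = ⊥) :
    H.F m = ⊤ := by
  rw [h.F_eq_biSup_deligneI m, eq_top_iff, ← h.iSup_deligneI_eq_top]
  refine iSup_le fun r => ?_
  by_cases hr : m ≤ r
  · exact le_iSup₂_of_le r hr le_rfl
  · rw [deligneI_diag_eq_bot_of_W_eq_bot hW (not_le.1 hr)]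
    exact bot_le

omit [FiniteDimensional ℚ V] in
/-- The weight filtration of `H / W_j H` vanishes up to `j`. [cite: CattaniElZeinGriffithsLe2014, Lemma 3.2.20] -/
theorem weight_quotient_W_eq_bot {j k : ℤ} (hkj : k ≤ j) :
    (SubMixedHodgeStructure.weight H j).quotient.W k = ⊥ := by
  rw [SubMixedHodgeStructure.quotient_W, eq_bot_iff]
  refine (Submodule.map_mono (H.monotone_W hkj)).trans (le_of_eq ?_)
  exact Submodule.mkQ_map_self _

omit [FiniteDimensional ℚ V] in
/-- `W_k (H / W_j H) = everything` when `W_k H = V`. [cite: CattaniElZeinGriffithsLe2014, Lemma 3.2.20] -/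
theorem weight_quotient_W_eq_top {j k : ℤ} (hk : H.W k = ⊤) :
    (SubMixedHodgeStructure.weight H j).quotient.W k = ⊤ := by
  rw [SubMixedHodgeStructure.quotient_W, hk, Submodule.map_top, Submodule.range_mkQ]

end Extreme

/-! ### §4 Morphisms to `ℚ(-m)` from a Hodge–Tate structure of weights `≤ 2m` -/

section HomTate

variable [FiniteDimensional ℚ V] {H : MixedHodgeStructure V}

/-- **For a Hodge–Tate structure with `W_{2m} = V`, every linear functional killing `W_{2m-1}` is a
morphism `H → ℚ(-m)`**: it factors through the quotient `H / W_{2m-1}`, a Hodge–Tate structure with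
the single weight `2m`, on which `F^{m+1} = 0` (§3), so §1 applies. [cite: Goncharov2001MultiplePolylogarithms, §3.1] -/
def IsHodgeTate.homTateOfLE (h : H.IsHodgeTate) {m : ℤ} (ht : H.W (2 * m) = ⊤) (φ : V →ₗ[ℚ] ℚ)
    (hφ : H.W (2 * m - 1) ≤ LinearMap.ker φ) : Hom H (tate (-m)).toMixedHodgeStructure :=
  (Hom.toTateOfBounds ((H.W (2 * m - 1)).liftQ φ hφ) m (weight_quotient_W_eq_bot le_rfl)
      ((h.quotient (SubMixedHodgeStructure.weight H (2 * m - 1))).F_succ_eq_bot_of_W_eq_top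
        (weight_quotient_W_eq_top ht))).comp
    (SubMixedHodgeStructure.weight H (2 * m - 1)).mkQ

/-- Underlying map of `IsHodgeTate.homTateOfLE`: the functional `φ` itself.
[cite: Goncharov2001MultiplePolylogarithms, §3.1] -/
@[simp]
theorem IsHodgeTate.homTateOfLE_toLinearMap (h : H.IsHodgeTate) {m : ℤ} (ht : H.W (2 * m) = ⊤)
    (φ : V →ₗ[ℚ] ℚ) (hφ : H.W (2 * m - 1) ≤ LinearMap.ker φ) : (h.homTateOfLE ht φ hφ).toLinearMap = φ :=
  (H.W (2 * m - 1)).liftQ_mkQ φ hφ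

/-- **`Hom(H, ℚ(-m)) ≃ (W_{2m-1} H)^⊥` for a Hodge–Tate structure with `W_{2m} = V`**: the morphisms
to the Tate structure of the top weight are exactly the linear functionals vanishing on `W_{2m-1}`
(the dual of `Hom(ℚ(-k), H) ≃ Hdgᵏ(H)`, the tree's `tateHomEquivHodgeClasses`; Goncharov's maps
`gr^W_{2m} M → K(-m)` of a framing). [cite: Goncharov2001MultiplePolylogarithms, §3.1] -/
def IsHodgeTate.homTateEquivDualAnnihilator (h : H.IsHodgeTate) {m : ℤ} (ht : H.W (2 * m) = ⊤) :
    Hom H (tate (-m)).toMixedHodgeStructure ≃ (H.W (2 * m - 1)).dualAnnihilator where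
  toFun g := ⟨g.toLinearMap, (Submodule.mem_dualAnnihilator _).2 fun _ hx => g.W_pred_le_ker hx⟩
  invFun φ := h.homTateOfLE ht φ.1 fun x hx => (Submodule.mem_dualAnnihilator φ.1).1 φ.2 x hx
  left_inv g := Hom.ext (h.homTateOfLE_toLinearMap ht g.toLinearMap _)
  right_inv φ := Subtype.ext (h.homTateOfLE_toLinearMap ht φ.1 _)

/-- `homTateEquivDualAnnihilator g = g` as a functional. [cite: Goncharov2001MultiplePolylogarithms, §3.1] -/
@[simp]
theorem IsHodgeTate.coe_homTateEquivDualAnnihilator (h : H.IsHodgeTate) {m : ℤ} (ht : H.W (2 * m) = ⊤)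
    (g : Hom H (tate (-m)).toMixedHodgeStructure) :
    ((h.homTateEquivDualAnnihilator ht g : (H.W (2 * m - 1)).dualAnnihilator) : Module.Dual ℚ V) = g.toLinearMap :=
  rfl

/-- **A Hodge–Tate structure with the single weight `2m` is "pure Tate": `Hom(H, ℚ(-m)) ≃ V^*`** —
every linear functional is a morphism. [cite: Goncharov2001MultiplePolylogarithms, §3.1] [cite: Marcolli2009, (2.49)] -/
def IsHodgeTate.homTateEquivDual (h : H.IsHodgeTate) {m : ℤ} (hb : H.W (2 * m - 1) = ⊥) (ht : H.W (2 * m) = ⊤) :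
    Hom H (tate (-m)).toMixedHodgeStructure ≃ Module.Dual ℚ V where
  toFun g := g.toLinearMap
  invFun φ := Hom.toTateOfBounds φ m hb (h.F_succ_eq_bot_of_W_eq_top ht)
  left_inv _ := Hom.ext rfl
  right_inv _ := rfl

/-- **… and `Hom(ℚ(-m), H) ≃ V`**: every vector spans a morphism from `ℚ(-m)` (evaluation at `1`).
[cite: Goncharov2001MultiplePolylogarithms, §3.1] [cite: Marcolli2009, (2.49)] -/
def IsHodgeTate.tateHomEquivOfPure (h : H.IsHodgeTate) {m : ℤ} (hb : H.W (2 * m - 1) = ⊥) (ht : H.W (2 * m) = ⊤) :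
    Hom (tate (-m)).toMixedHodgeStructure H ≃ V where
  toFun f := f.toLinearMap 1
  invFun v := Hom.ofTateOfBounds v m ht (h.F_eq_top_of_W_pred_eq_bot hb)
  left_inv f := Hom.ext (LinearMap.ext_ring (by rw [Hom.ofTateOfBounds_toLinearMap_apply, one_smul]))
  right_inv v := by
    change (1 : ℚ) • v = v
    rw [one_smul]

end HomTate

/-! ### §5 The top Tate quotient -/

section TopQuotient

variable [FiniteDimensional ℚ V] {H : MixedHodgeStructure V}

/-- **Every non-zero Hodge–Tate structure maps ONTO a Tate structure**: with `2m` the highest weight,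
the quotient `H / W_{2m-1} H ≠ 0` is Hodge–Tate with the single weight `2m`, so any non-zero linear
functional on it is a surjective morphism to `ℚ(-m)` (§1, §3); compose with `H ↠ H / W_{2m-1} H`.
[cite: Goncharov2001MultiplePolylogarithms, §3.1] [cite: Marcolli2009, (2.49)] -/
theorem IsHodgeTate.exists_hom_tate_surjective [Nontrivial V] (h : H.IsHodgeTate) :
    ∃ (m : ℤ) (g : Hom H (tate (-m)).toMixedHodgeStructure), Function.Surjective g.toLinearMap := by
  obtain ⟨m, ht, hne⟩ := h.exists_highestWeight_even
  haveI : Nontrivial (V ⧸ H.W (2 * m - 1)) := Submodule.Quotient.nontrivial_iff.2 hne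
  obtain ⟨q, hq⟩ := exists_ne (0 : V ⧸ H.W (2 * m - 1))
  obtain ⟨ψ, hψ⟩ := Module.Projective.exists_dual_eq_one ℚ hq
  refine ⟨m, h.homTateOfLE ht (ψ ∘ₗ (H.W (2 * m - 1)).mkQ) ?_, fun c => ?_⟩
  · intro x hx
    rw [LinearMap.mem_ker, LinearMap.comp_apply, Submodule.mkQ_apply,
      (Submodule.Quotient.mk_eq_zero _).2 hx, map_zero]
  · obtain ⟨v, hv⟩ := Submodule.mkQ_surjective (H.W (2 * m - 1)) (c • q)
    refine ⟨v, ?_⟩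
    rw [IsHodgeTate.homTateOfLE_toLinearMap, LinearMap.comp_apply, hv, map_smul, hψ, smul_eq_mul, mul_one]

omit [FiniteDimensional ℚ V] in
/-- **The top Tate quotient as an extension**: a surjective morphism `g : H ↠ ℚ(-m)` presents `H` as
an extension `0 → Ker g → H → ℚ(-m) → 0` of the Tate structure BY the sub-MHS `Ker g` (the shape of
the tree's `Ext.tateEquivJacobianW : Ext(ℚ(-m), K) ≃ J⁰_W(K(m))`). [cite: Goncharov2001MultiplePolylogarithms, §3.1] -/
def tateQuotientExtension {m : ℤ} (g : Hom H (tate (-m)).toMixedHodgeStructure)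
    (hg : Function.Surjective g.toLinearMap) :
    Extension (tate (-m)).toMixedHodgeStructure g.ker.toMixedHodgeStructure V :=
  Extension.ofExact H g.ker.subtype g g.ker_subtype_injective hg g.exact_ker_subtype

omit [FiniteDimensional ℚ V] in
/-- The middle structure of `tateQuotientExtension g` is `H` itself (by `rfl`).
[cite: Goncharov2001MultiplePolylogarithms, §3.1] -/
@[simp]
theorem tateQuotientExtension_mhs {m : ℤ} (g : Hom H (tate (-m)).toMixedHodgeStructure)
    (hg : Function.Surjective g.toLinearMap) : (tateQuotientExtension g hg).mhs = H := rfl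

/-- **Dévissage from the top**: a non-zero Hodge–Tate structure `H` is an extension
`0 → K → H → ℚ(-m) → 0` of a Tate structure by a Hodge–Tate structure `K ⊆ H` with
`dim K + 1 = dim H` (iterate: `𝓗_T` is generated by the `ℚ(n)` under extensions).
[cite: Goncharov2001MultiplePolylogarithms, §3.1] [cite: Marcolli2009, (2.49)] -/
theorem IsHodgeTate.exists_extension_tate_quotient [Nontrivial V] (h : H.IsHodgeTate) :
    ∃ (m : ℤ) (K : SubMixedHodgeStructure H)
      (E : Extension (tate (-m)).toMixedHodgeStructure K.toMixedHodgeStructure V),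
      E.mhs = H ∧ K.toMixedHodgeStructure.IsHodgeTate ∧ finrank ℚ K.toSubmodule + 1 = finrank ℚ V := by
  obtain ⟨m, g, hg⟩ := h.exists_hom_tate_surjective
  refine ⟨m, g.ker, tateQuotientExtension g hg, rfl, h.ker g, ?_⟩
  have hrk := LinearMap.finrank_range_add_finrank_ker g.toLinearMap
  rw [LinearMap.range_eq_top.2 hg, finrank_top, Module.finrank_self] at hrk
  rw [Hom.ker_toSubmodule]
  omega

end TopQuotient

end MixedHodgeStructure

end Literature.AlgebraicGeometry.Motives
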